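import Summits.ValiantsHypothesis.ValiantsHypothesis.Theorems.RigidityForcesSymmetryGrenetFirstOrderRankRigidOverlapDesign
import Summits.ValiantsHypothesis.ValiantsHypothesis.Theorems.RigidityForcesSymmetryGrenetFirstOrderRankRigidOverlapSnake

/-!
# Route RigidityForcesSymmetry — `GrenetFirstOrderRankRigid` (item stmt-ValiantsHypothesis-21029),
line `grenet_gauge`: stub `stub_linearRigid`, step 5 (block I>, part 7) — the overlap blocks of type I>

For the crux line `Cruxes/GrenetFirstOrderRankRigid/Lines/grenet_gauge.lean` (blueprint
`Lines/grenet_gauge-stub_linearRigid-PROOF.md`, §5, type I>; interface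
`Lines/grenet_gauge-stub_linearRigid-BLOCKS.md`, deliverables (D-PQ), (D-tail), (D-head) for TYPE I>).

A tail entry `(S, T, (p, |S|))` (arc `S → U := S + p`, row vertex `S = R i`, column vertex `T = C j`)
and a head entry `(U, T + p', (p', |T|))` of a homogeneous, rank-constrained tangent direction at
Grenet's pencil belong to the pair `(U, T)`; the pair is of TYPE I> when `|T| < |U|` (overlap) and
`T ⊄ U` (equivalently `0 < |T \\ U| < |U \\ T|`).  Then:

* `grenet_overlap_PQ_of_snake` — `A'(head) = - A'(tail)` whenever the snake design through the two
  entries is dominated: `p' ∈ U` with `p' ≠ p` or `|T| = |S|` (forward), or `p' ∉ U`, `p ∉ T` (backward)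
  (`exists_overlap_snake` + `grenet_overlap_PQ_of_design` / `…'`);
* `grenet_overlap_PQ` — **(D-PQ) for type I>** in general: the two remaining configurations
  (`p' = p` with a wider overlap; `p' ∉ U` with `p ∈ T`) follow from three dominated snakes through
  auxiliary entries of the same pair (`|U \\ T| ≥ |S| + 2 - |T|` leaves room for them);
* `grenet_overlap_tail`, `grenet_overlap_head` — **(D-tail), (D-head) for type I>**: two tail (head)
  entries of the same pair agree (both are `-A'` of a common partner).

Genuineness of the entries is not needed.  No new definitions.  VP ≠ VNP is not moved by this file
(first-order bookkeeping about one matrix family).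
-/

noncomputable section

open MvPolynomial Matrix Finset

namespace Summit.ValiantsHypothesis.Theorems.RigidityForcesSymmetry.GrenetGauge

open Literature.Computability.AlgebraicComplexity

section BlockIgt

variable {k : Type*} [CommRing k] [IsDomain k] {n N : ℕ} (e : Finset (Fin n) ≃ Fin (N + 1))

/-- Room for auxiliary rows in an overlap pair: if `U = S + p` (`p ∉ S`) and `T ⊄ U` then
`|S| + 2 ≤ |U \\ T| + |T|`. [folklore] -/
theorem overlap_card_sdiff {S U T : Finset (Fin n)} {p : Fin n} (hpS : p ∉ S) (hU : insert p S = U)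
    (hB : ¬ T ⊆ U) : S.card + 2 ≤ (U \ T).card + T.card := by
  obtain ⟨b₀, hb₀T, hb₀U⟩ := Finset.not_subset.mp hB
  have h1 : (U \ T).card + (U ∩ T).card = U.card := Finset.card_sdiff_add_card_inter U T
  have h2 : (U ∩ T).card < T.card :=
    Finset.card_lt_card (Finset.ssubset_iff_subset_ne.mpr ⟨Finset.inter_subset_right,
      fun h => hb₀U (Finset.mem_inter.mp (h.symm ▸ hb₀T)).1⟩)
  have h3 : U.card = S.card + 1 := by rw [← hU, Finset.card_insert_of_notMem hpS]
  omega

/-- **`A'(head) = - A'(tail)` for the dominated snakes of an overlap pair** (type I>).  Let `(i, j, v)`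
be a TAIL entry (`v = (p, |S|)`, `p ∉ S = R i`, `U := S + p = R i'`) and `(i', j', v')` a HEAD entry
(`v' = (p', |T|)`, `T = C j = C j' - p'`) of a homogeneous, rank-constrained tangent direction at
Grenet's pencil, with `|T| ≤ |S|` and `T ⊄ U`.  If `p' ∈ U` and (`p' ≠ p` or `|T| = |S|`), or if
`p' ∉ U` and `p ∉ T`, then `A'_{v'} i' j' = - A'_v i j` (the snake design through the two entries,
`exists_overlap_snake`, is forward- resp. backward-dominated). [cite: Grenet2011, Thm. 1] -/
theorem grenet_overlap_PQ_of_snake (hn : n ≠ 0) (hN : 2 ^ n = N + 1)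
    (A' : Fin n × Fin n → Matrix (Fin N) (Fin N) k)
    (htr : ((Grenet.repr k n e).adjugate * ∑ v, (X v : MvPolynomial (Fin n × Fin n) k) • (A' v).map C).trace = 0)
    (hsupp : ∀ (w : Fin n × Fin n) (a b : Fin N), A' w a b ≠ 0 →
      (w.1 ∉ e.symm ((e univ).succAbove a) ∧ (w.2 : ℕ) = (e.symm ((e univ).succAbove a)).card) ∨
      (w.1 ∈ e.symm ((e ∅).succAbove b) ∧ (e.symm ((e ∅).succAbove b)).card = (w.2 : ℕ) + 1))
    {i j : Fin N} {v : Fin n × Fin n} {i' j' : Fin N} {v' : Fin n × Fin n}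
    (htail : v.1 ∉ e.symm ((e univ).succAbove i) ∧ (v.2 : ℕ) = (e.symm ((e univ).succAbove i)).card)
    (hhead : v'.1 ∈ e.symm ((e ∅).succAbove j') ∧ (e.symm ((e ∅).succAbove j')).card = (v'.2 : ℕ) + 1)
    (hU : insert v.1 (e.symm ((e univ).succAbove i)) = e.symm ((e univ).succAbove i'))
    (hT : e.symm ((e ∅).succAbove j) = (e.symm ((e ∅).succAbove j')).erase v'.1)
    (hle : (e.symm ((e ∅).succAbove j)).card ≤ (e.symm ((e univ).succAbove i)).card)
    (hB : ¬ e.symm ((e ∅).succAbove j) ⊆ e.symm ((e univ).succAbove i'))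
    (hfam : (v'.1 ∈ e.symm ((e univ).succAbove i') ∧
        (v'.1 ≠ v.1 ∨ (e.symm ((e ∅).succAbove j)).card = (e.symm ((e univ).succAbove i)).card)) ∨
      (v'.1 ∉ e.symm ((e univ).succAbove i') ∧ v.1 ∉ e.symm ((e ∅).succAbove j))) :
    A' v' i' j' = -A' v i j := by
  classical
  set S := e.symm ((e univ).succAbove i) with hSdef
  set T := e.symm ((e ∅).succAbove j) with hTdef
  set U := e.symm ((e univ).succAbove i') with hUdef
  set T' := e.symm ((e ∅).succAbove j') with hT'def
  have hpS : v.1 ∉ S := htail.1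
  have hq : (v.2 : ℕ) = S.card := htail.2
  have hp'T : v'.1 ∉ T := by rw [hT]; exact Finset.notMem_erase _ _
  have hTcard : T.card = (v'.2 : ℕ) := by
    have h1 := Finset.card_erase_of_mem hhead.1
    rw [← hT] at h1
    omega
  have hpU : v.1 ∈ U := by rw [← hU]; exact Finset.mem_insert_self _ _
  obtain ⟨d₁, d₂, h1inj, h1img, h1top, h2inj, h2avoid, h2bot, hmidF, hmidB, hendF, hendB⟩ :=
    exists_overlap_snake S U T v.1 v'.1 hpS hU hp'T hle hB
  rcases hfam with ⟨hp'U, hne⟩ | ⟨hp'U, hpT⟩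
  · -- forward-dominated snake
    refine grenet_overlap_PQ_of_design e hn hN A' htr hsupp htail hhead hU hT hle hB d₁ d₂ h1inj h1img
      (h1top v.2 hq) h2inj h2avoid (h2bot v'.2 hTcard.symm) (fun c hc1 hc2 => ?_) (fun c hc1 hc2 => ?_)
    · rw [← hTdef] at hc1
      rw [← hSdef] at hc2
      rcases (Nat.lt_or_eq_of_le hc1) with h | h
      · exact hmidF c h hc2
      · -- the bottom overlap column `c = t`: `d₂ c = p'`
        rw [h2bot c h.symm]
        by_cases hpp : v'.1 = v.1
        · -- degenerate snake: `|T| = |S|`, the single overlap column carries `p = p'` for both maps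
          have hts : T.card = S.card := hne.resolve_left (not_not_intro hpp)
          exact ⟨c, le_rfl, by rw [h1top c (by omega), ← hpp]⟩
        · obtain ⟨c', hc', hc'eq⟩ := hendF hp'U hpp
          exact ⟨c', by omega, hc'eq⟩
    · rw [← hTdef] at hc1 ⊢
      rw [← hSdef] at hc2
      rcases (Nat.lt_or_eq_of_le hc2) with h | h
      · exact Or.inr (hmidB c hc1 h)
      · -- the top overlap column `c = s₀`: `d₁ c = p`
        rw [h1top c h]
        by_cases hpT : v.1 ∈ T
        · exact Or.inl hpT
        · right
          by_cases hpp : v.1 = v'.1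
          · have hts : T.card = S.card := hne.resolve_left (fun h' => h' hpp.symm)
            exact ⟨c, le_rfl, by rw [h2bot c (by omega), ← hpp]⟩
          · obtain ⟨c', hc', hc'eq⟩ := hendB hpT hpp
            exact ⟨c', by omega, hc'eq⟩
  · -- backward-dominated snake
    refine grenet_overlap_PQ_of_design' e hn hN A' htr hsupp htail hhead hU hT hle hB d₁ d₂ h1inj h1img
      (h1top v.2 hq) h2inj h2avoid (h2bot v'.2 hTcard.symm) (fun c hc1 hc2 => ?_) (fun c hc1 hc2 => ?_)
    · rw [← hTdef] at hc1
      rw [← hSdef] at hc2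
      rw [← hUdef]
      rcases (Nat.lt_or_eq_of_le hc1) with h | h
      · exact Or.inr (hmidF c h hc2)
      · left
        rw [h2bot c h.symm]
        exact hp'U
    · rw [← hTdef] at hc1
      rw [← hSdef] at hc2
      rcases (Nat.lt_or_eq_of_le hc2) with h | h
      · exact hmidB c hc1 h
      · rw [h1top c h]
        obtain ⟨c', hc', hc'eq⟩ := hendB hpT (fun h' => hp'U (h' ▸ hpU))
        exact ⟨c', by omega, hc'eq⟩

/-- **(D-PQ) for type I>.**  Let `(i, j, v)` be a TAIL entry (`v = (p, |S|)`, `p ∉ S = R i`,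
`U := S + p = R i'`) and `(i', j', v')` a HEAD entry (`v' = (p', |T|)`, `T = C j = C j' - p'`) of a
homogeneous, rank-constrained tangent direction at Grenet's pencil, of the same pair `(U, T)` of type
I> (`|T| ≤ |S|`, `T ⊄ U`).  Then `A'_{v'} i' j' = - A'_v i j`.  (The dominated snakes give this
directly unless `p' = p` with `|T| < |S|`, or `p' ∉ U` with `p ∈ T`; in these two cases combine three
dominated snakes through auxiliary rows of `U \\ T`, of which there are at least `|S| + 2 - |T|`.)
[cite: Grenet2011, Thm. 1] -/
theorem grenet_overlap_PQ (hn : n ≠ 0) (hN : 2 ^ n = N + 1)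
    (A' : Fin n × Fin n → Matrix (Fin N) (Fin N) k)
    (htr : ((Grenet.repr k n e).adjugate * ∑ v, (X v : MvPolynomial (Fin n × Fin n) k) • (A' v).map C).trace = 0)
    (hsupp : ∀ (w : Fin n × Fin n) (a b : Fin N), A' w a b ≠ 0 →
      (w.1 ∉ e.symm ((e univ).succAbove a) ∧ (w.2 : ℕ) = (e.symm ((e univ).succAbove a)).card) ∨
      (w.1 ∈ e.symm ((e ∅).succAbove b) ∧ (e.symm ((e ∅).succAbove b)).card = (w.2 : ℕ) + 1))
    {i j : Fin N} {v : Fin n × Fin n} {i' j' : Fin N} {v' : Fin n × Fin n}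
    (htail : v.1 ∉ e.symm ((e univ).succAbove i) ∧ (v.2 : ℕ) = (e.symm ((e univ).succAbove i)).card)
    (hhead : v'.1 ∈ e.symm ((e ∅).succAbove j') ∧ (e.symm ((e ∅).succAbove j')).card = (v'.2 : ℕ) + 1)
    (hU : insert v.1 (e.symm ((e univ).succAbove i)) = e.symm ((e univ).succAbove i'))
    (hT : e.symm ((e ∅).succAbove j) = (e.symm ((e ∅).succAbove j')).erase v'.1)
    (hle : (e.symm ((e ∅).succAbove j)).card ≤ (e.symm ((e univ).succAbove i)).card)
    (hB : ¬ e.symm ((e ∅).succAbove j) ⊆ e.symm ((e univ).succAbove i')) :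
    A' v' i' j' = -A' v i j := by
  classical
  set S := e.symm ((e univ).succAbove i) with hSdef
  set T := e.symm ((e ∅).succAbove j) with hTdef
  set U := e.symm ((e univ).succAbove i') with hUdef
  set T' := e.symm ((e ∅).succAbove j') with hT'def
  have hpS : v.1 ∉ S := htail.1
  have hq : (v.2 : ℕ) = S.card := htail.2
  have hp'T' : v'.1 ∈ T' := hhead.1
  have hp'T : v'.1 ∉ T := by rw [hT]; exact Finset.notMem_erase _ _
  have hT'eq : T' = insert v'.1 T := by rw [hT, Finset.insert_erase hp'T']
  have hTcard : T.card = (v'.2 : ℕ) := by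
    have h1 := Finset.card_erase_of_mem hp'T'
    rw [← hT] at h1
    omega
  have hpU : v.1 ∈ U := by rw [← hU]; exact Finset.mem_insert_self _ _
  have hUcard : U.card = S.card + 1 := by rw [← hU, Finset.card_insert_of_notMem hpS]
  have hSU : U.erase v.1 = S := by rw [← hU, Finset.erase_insert hpS]
  have hA := overlap_card_sdiff hpS hU hB
  -- the dominated snakes, for arbitrary entries of the pair `(U, T)`
  have key : ∀ (q q' : Fin n) (iq jq' : Fin N),
      e.symm ((e univ).succAbove iq) = U.erase q → q ∈ U →
      e.symm ((e ∅).succAbove jq') = insert q' T → q' ∉ T →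
      ((q' ∈ U ∧ (q' ≠ q ∨ T.card = S.card)) ∨ (q' ∉ U ∧ q ∉ T)) →
      A' (q', v'.2) i' jq' = -A' (q, v.2) iq j := by
    intro q q' iq jq' hiq hqU hjq' hq'T hfam
    have hcq : (U.erase q).card = S.card := by rw [Finset.card_erase_of_mem hqU, hUcard]; rfl
    refine grenet_overlap_PQ_of_snake e hn hN A' htr hsupp (i := iq) (j := j) (v := (q, v.2))
      (i' := i') (j' := jq') (v' := (q', v'.2)) ⟨by rw [hiq]; exact Finset.notMem_erase _ _, by rw [hiq, hcq, hq]⟩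
      ⟨by rw [hjq']; exact Finset.mem_insert_self _ _, by rw [hjq', Finset.card_insert_of_notMem hq'T, hTcard]⟩
      (by rw [hiq, Finset.insert_erase hqU]) (by rw [hjq', Finset.erase_insert hq'T]) (by rw [hiq, hcq]; exact hle)
      hB ?_
    rcases hfam with ⟨h1, h2⟩ | ⟨h1, h2⟩
    · exact Or.inl ⟨h1, h2.imp id fun h => by rw [hiq, hcq]; exact h⟩
    · exact Or.inr ⟨h1, h2⟩
  -- auxiliary index triples
  have hrow : ∀ q : Fin n, ∃ iq : Fin N, e.symm ((e univ).succAbove iq) = U.erase q := fun q =>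
    exists_grenet_row_eq e fun h => Finset.notMem_erase q U (h ▸ Finset.mem_univ q)
  have hcol : ∀ q' : Fin n, ∃ jq' : Fin N, e.symm ((e ∅).succAbove jq') = insert q' T := fun q' =>
    exists_grenet_col_eq e (Finset.insert_ne_empty _ _)
  have hmain : A' (v'.1, v'.2) i' j' = -A' (v.1, v.2) i j := by
    by_cases hp'U : v'.1 ∈ U
    · by_cases h1 : v'.1 ≠ v.1 ∨ T.card = S.card
      · exact key v.1 v'.1 i j' hSU.symm hpU hT'eq hp'T (Or.inl ⟨hp'U, h1⟩)
      · -- `p' = p ∈ U \ T` and `|T| < |S|`: two more rows `β ≠ γ` of `U \ T`, three snakes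
        rw [not_or, not_not] at h1
        obtain ⟨hpp, hts⟩ := h1
        have hcard : 1 < ((U \ T).erase v.1).card := by
          have := Finset.pred_card_le_card_erase (s := U \ T) (a := v.1)
          omega
        obtain ⟨β, hβ, γ, hγ, hβγ⟩ := Finset.one_lt_card.mp hcard
        simp only [Finset.mem_erase, Finset.mem_sdiff] at hβ hγ
        obtain ⟨iγ, hiγ⟩ := hrow γ
        obtain ⟨jβ, hjβ⟩ := hcol β
        have E1 := key v.1 β i jβ hSU.symm hpU hjβ hβ.2.2 (Or.inl ⟨hβ.2.1, Or.inl hβ.1⟩)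
        have E2 := key γ v'.1 iγ j' hiγ hγ.2.1 hT'eq hp'T
          (Or.inl ⟨hp'U, Or.inl (by rw [hpp]; exact fun h => hγ.1 h.symm)⟩)
        have E3 := key γ β iγ jβ hiγ hγ.2.1 hjβ hβ.2.2 (Or.inl ⟨hβ.2.1, Or.inl hβγ⟩)
        linear_combination E2 - E3 + E1
    · by_cases hpT : v.1 ∈ T
      · -- `p ∈ U ∩ T`, `p' ∉ U`: two rows `α ≠ β` of `U \ T`, three snakes
        have hcard : 1 < (U \ T).card := by omega
        obtain ⟨α, hα, β, hβ, hαβ⟩ := Finset.one_lt_card.mp hcard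
        rw [Finset.mem_sdiff] at hα hβ
        obtain ⟨iα, hiα⟩ := hrow α
        obtain ⟨jβ, hjβ⟩ := hcol β
        have E1 := key v.1 β i jβ hSU.symm hpU hjβ hβ.2 (Or.inl ⟨hβ.1, Or.inl fun h => hβ.2 (h ▸ hpT)⟩)
        have E2 := key α β iα jβ hiα hα.1 hjβ hβ.2 (Or.inl ⟨hβ.1, Or.inl (Ne.symm hαβ)⟩)
        have E3 := key α v'.1 iα j' hiα hα.1 hT'eq hp'T (Or.inr ⟨hp'U, hα.2⟩)
        linear_combination E3 - E2 + E1
      · exact key v.1 v'.1 i j' hSU.symm hpU hT'eq hp'T (Or.inr ⟨hp'U, hpT⟩)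
  exact hmain

/-- **(D-tail) for type I>.**  Two tail entries `(i, j, v)`, `(i₂, j, v₂)` of a homogeneous,
rank-constrained tangent direction at Grenet's pencil with the same arc target
`R i + v.1 = R i₂ + v₂.1 =: U` and the same column vertex `T = C j`, `|T| ≤ |R i|`, `T ⊄ U`, have equal
values: both are `-A'` of a common head partner (`grenet_overlap_PQ`). [cite: Grenet2011, Thm. 1] -/
theorem grenet_overlap_tail (hn : n ≠ 0) (hN : 2 ^ n = N + 1)
    (A' : Fin n × Fin n → Matrix (Fin N) (Fin N) k)
    (htr : ((Grenet.repr k n e).adjugate * ∑ v, (X v : MvPolynomial (Fin n × Fin n) k) • (A' v).map C).trace = 0)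
    (hsupp : ∀ (w : Fin n × Fin n) (a b : Fin N), A' w a b ≠ 0 →
      (w.1 ∉ e.symm ((e univ).succAbove a) ∧ (w.2 : ℕ) = (e.symm ((e univ).succAbove a)).card) ∨
      (w.1 ∈ e.symm ((e ∅).succAbove b) ∧ (e.symm ((e ∅).succAbove b)).card = (w.2 : ℕ) + 1))
    {i j : Fin N} {v : Fin n × Fin n} {i₂ : Fin N} {v₂ : Fin n × Fin n}
    (htail : v.1 ∉ e.symm ((e univ).succAbove i) ∧ (v.2 : ℕ) = (e.symm ((e univ).succAbove i)).card)
    (htail₂ : v₂.1 ∉ e.symm ((e univ).succAbove i₂) ∧ (v₂.2 : ℕ) = (e.symm ((e univ).succAbove i₂)).card)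
    (hUU : insert v.1 (e.symm ((e univ).succAbove i)) = insert v₂.1 (e.symm ((e univ).succAbove i₂)))
    (hle : (e.symm ((e ∅).succAbove j)).card ≤ (e.symm ((e univ).succAbove i)).card)
    (hB : ¬ e.symm ((e ∅).succAbove j) ⊆ insert v.1 (e.symm ((e univ).succAbove i))) :
    A' v i j = A' v₂ i₂ j := by
  classical
  set S := e.symm ((e univ).succAbove i) with hSdef
  set T := e.symm ((e ∅).succAbove j) with hTdef
  obtain ⟨b₀, hb₀T, hb₀U⟩ := Finset.not_subset.mp hB
  -- the common row vertex `U` and a head partner `(i', j', v')`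
  obtain ⟨i', hi'⟩ := exists_grenet_row_eq e (S := insert v.1 S) fun h => hb₀U (h ▸ Finset.mem_univ _)
  have hTn : T.card < n := by
    have h1 : S.card < n := by
      have := (Finset.card_lt_iff_ne_univ _).mpr (grenet_row_ne_univ e i)
      rwa [Fintype.card_fin] at this
    omega
  obtain ⟨p', hp'⟩ : ∃ p', p' ∉ T := by
    by_contra h
    push Not at h
    have := Finset.card_le_card (fun x _ => h x : (univ : Finset (Fin n)) ⊆ T)
    rw [Finset.card_univ, Fintype.card_fin] at this
    omega
  obtain ⟨j', hj'⟩ := exists_grenet_col_eq e (Finset.insert_ne_empty p' T)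
  have hhead : ((p', (⟨T.card, hTn⟩ : Fin n)) : Fin n × Fin n).1 ∈ e.symm ((e ∅).succAbove j') ∧
      (e.symm ((e ∅).succAbove j')).card = ((((p', (⟨T.card, hTn⟩ : Fin n)) : Fin n × Fin n).2 : Fin n) : ℕ) + 1 := by
    refine ⟨by rw [hj']; exact Finset.mem_insert_self _ _, ?_⟩
    rw [hj', Finset.card_insert_of_notMem hp']
  have hT : T = (e.symm ((e ∅).succAbove j')).erase ((p', (⟨T.card, hTn⟩ : Fin n)) : Fin n × Fin n).1 := by
    rw [hj', Finset.erase_insert hp']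
  have hB' : ¬ T ⊆ e.symm ((e univ).succAbove i') := by rw [hi']; exact hB
  have h1 := grenet_overlap_PQ e hn hN A' htr hsupp htail hhead hi'.symm hT hle hB'
  have hle₂ : T.card ≤ (e.symm ((e univ).succAbove i₂)).card := by
    have h2 : (insert v.1 S).card = (insert v₂.1 (e.symm ((e univ).succAbove i₂))).card := by rw [hUU]
    rw [Finset.card_insert_of_notMem htail.1, Finset.card_insert_of_notMem htail₂.1] at h2
    omega
  have h2 := grenet_overlap_PQ e hn hN A' htr hsupp htail₂ hhead (hUU ▸ hi'.symm) hT hle₂ hB'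
  rw [h1] at h2
  exact neg_inj.mp h2

/-- **(D-head) for type I>.**  Two head entries `(i, j, v)`, `(i, j₂, v₂)` of a homogeneous,
rank-constrained tangent direction at Grenet's pencil with the same row vertex `U = R i` and the same
arc source `C j - v.1 = C j₂ - v₂.1 =: T`, `|T| < |U|`, `T ⊄ U`, have equal values: both are `-A'` of a
common tail partner (`grenet_overlap_PQ`). [cite: Grenet2011, Thm. 1] -/
theorem grenet_overlap_head (hn : n ≠ 0) (hN : 2 ^ n = N + 1)
    (A' : Fin n × Fin n → Matrix (Fin N) (Fin N) k)
    (htr : ((Grenet.repr k n e).adjugate * ∑ v, (X v : MvPolynomial (Fin n × Fin n) k) • (A' v).map C).trace = 0)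
    (hsupp : ∀ (w : Fin n × Fin n) (a b : Fin N), A' w a b ≠ 0 →
      (w.1 ∉ e.symm ((e univ).succAbove a) ∧ (w.2 : ℕ) = (e.symm ((e univ).succAbove a)).card) ∨
      (w.1 ∈ e.symm ((e ∅).succAbove b) ∧ (e.symm ((e ∅).succAbove b)).card = (w.2 : ℕ) + 1))
    {i j : Fin N} {v : Fin n × Fin n} {j₂ : Fin N} {v₂ : Fin n × Fin n}
    (hhead : v.1 ∈ e.symm ((e ∅).succAbove j) ∧ (e.symm ((e ∅).succAbove j)).card = (v.2 : ℕ) + 1)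
    (hhead₂ : v₂.1 ∈ e.symm ((e ∅).succAbove j₂) ∧ (e.symm ((e ∅).succAbove j₂)).card = (v₂.2 : ℕ) + 1)
    (hRR : (e.symm ((e ∅).succAbove j)).erase v.1 = (e.symm ((e ∅).succAbove j₂)).erase v₂.1)
    (hlt : ((e.symm ((e ∅).succAbove j)).erase v.1).card < (e.symm ((e univ).succAbove i)).card)
    (hB : ¬ (e.symm ((e ∅).succAbove j)).erase v.1 ⊆ e.symm ((e univ).succAbove i)) :
    A' v i j = A' v₂ i j₂ := by
  classical
  set U := e.symm ((e univ).succAbove i) with hUdef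
  set T := (e.symm ((e ∅).succAbove j)).erase v.1 with hTdef
  have hTU : T.card < U.card := hlt
  obtain ⟨b₀, hb₀T, hb₀U⟩ := Finset.not_subset.mp hB
  -- a common tail partner `(i₁, j₁, v₁)` through some `p ∈ U`
  have hUne : U.Nonempty := Finset.card_pos.mp (by omega)
  obtain ⟨p, hp⟩ := hUne
  obtain ⟨i₁, hi₁⟩ := exists_grenet_row_eq e (S := U.erase p) fun h =>
    Finset.notMem_erase p U (h ▸ Finset.mem_univ p)
  obtain ⟨j₁, hj₁⟩ := exists_grenet_col_eq e (S := T) (Finset.nonempty_iff_ne_empty.mp ⟨b₀, hb₀T⟩)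
  have hUn : U.card - 1 < n := by
    have h1 : U.card < n := by
      rw [hUdef]
      have := (Finset.card_lt_iff_ne_univ _).mpr (grenet_row_ne_univ e i)
      rwa [Fintype.card_fin] at this
    omega
  have htail : ((p, (⟨U.card - 1, hUn⟩ : Fin n)) : Fin n × Fin n).1 ∉ e.symm ((e univ).succAbove i₁) ∧
      ((((p, (⟨U.card - 1, hUn⟩ : Fin n)) : Fin n × Fin n).2 : Fin n) : ℕ)
        = (e.symm ((e univ).succAbove i₁)).card := by
    refine ⟨by rw [hi₁]; exact Finset.notMem_erase _ _, ?_⟩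
    rw [hi₁, Finset.card_erase_of_mem hp]
  have hU' : insert ((p, (⟨U.card - 1, hUn⟩ : Fin n)) : Fin n × Fin n).1 (e.symm ((e univ).succAbove i₁)) = U := by
    rw [hi₁, Finset.insert_erase hp]
  have hle : (e.symm ((e ∅).succAbove j₁)).card ≤ (e.symm ((e univ).succAbove i₁)).card := by
    rw [hj₁, hi₁, Finset.card_erase_of_mem hp]
    omega
  have hB' : ¬ e.symm ((e ∅).succAbove j₁) ⊆ U := by rw [hj₁]; exact hB
  have h1 := grenet_overlap_PQ e hn hN A' htr hsupp htail hhead hU' hj₁ hle hB'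
  have h2 := grenet_overlap_PQ e hn hN A' htr hsupp htail hhead₂ hU' (hj₁.trans hRR) hle hB'
  rw [h1, h2]

end BlockIgt

end Summit.ValiantsHypothesis.Theorems.RigidityForcesSymmetry.GrenetGauge
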